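import Mathlib
import Summits.ResolutionOfSingularities.ResolutionOfSingularities.Theorems.FrobeniusClosingSteerRadicandSingularCriterion
import Literature.AlgebraicGeometry.Resolution.LocalBlowup

/-!
# Every steered stage is singular at the closed point (chain W4.1, crux `Steer`, σ-residual LOW, piece D3d — run level)

OURS (campaign res-hironaka, rung L, slot W4.1; helper for crux `Steer` stmt-ResolutionOfSingularities-16345; the
run-level half of res-L0-w41-idea-3's card-3 piece D3d «every steered LOW stage is singular at 𝔪», res-L0-w41-plan-1
RULING 18d → res-L0-w41-stub-3). NOT a statement of any manuscript; nothing here is attributed to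
[claim: Hironaka2017, status: under-review]. AI-written; weaker than expert review.

σ_top only moves where the radicand is a `p`-th power to second order: at a permissible centre `P` one has
`f − g^p ∈ P^p ⊆ 𝔪²`, at a point step `f − g^p ∈ 𝔪^p ⊆ 𝔪²`. Hence (res-type-082's criterion
`RadicandSingular.not_isRegularLocalRing_adjoinRoot_iff`) the radicand germ `R[T]/(T^p − f)` over every member of a
steered run is NOT regular, and this persists under any surjection of local rings `R → A` (e.g. onto the critical
surface `A = R/(e₁, e₂)` of the LOW tower) and along any ring isomorphism `Y ≅ A[T]/(T^p − h)`:
* `exists_sub_pow_mem_sq_of_centre` — the σ_top dichotomy (abstract `Perm`, as in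
  `SteeredRun.isRegularLocalRing_of_steeredRunUpTo`) gives `∃ g, f − g^p ∈ 𝔪²`;
* `exists_sub_pow_mem_sq_map` — the witness descends along a ring map sending `𝔪_R` into `𝔪_A`;
* `not_isRegularLocalRing_of_ringEquiv_adjoinRoot` — `Y ≅ A[T]/(T^p − h)` with `h − g^p ∈ 𝔪_A²` is not regular;
* `steeredStage_singular` — along a steered run (abstract `Perm`), every radicand germ `(R i)[T]/(T^p − s_i^p)` is
  singular.
[folklore]
-/

noncomputable section

-- `Summit.<S>.<S>.…` duplicates the summit name by design (single-problem summit).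
set_option linter.dupNamespace false

namespace Summit.ResolutionOfSingularities.ResolutionOfSingularities.Theorems.SwitchingDichotomy.LowStageSingular

open IsLocalRing Polynomial Literature.AlgebraicGeometry.Resolution
open Summit.ResolutionOfSingularities.ResolutionOfSingularities.Theorems.SwitchingDichotomy

universe u v

/-- **σ_top moves only at `p`-th powers to second order**: from the σ_top dichotomy at a stage — a proper centre `P`
with `f − g^p ∈ P^p` (the consumed part of permissibility), or the point with `f − g^p ∈ 𝔪^p` — some `g` has
`f − g^p ∈ 𝔪²` (`p ≥ 2`). [folklore] -/
theorem exists_sub_pow_mem_sq_of_centre {S : Type u} [CommRing S] [IsLocalRing S] {p : ℕ} (hp : 2 ≤ p)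
    (f : S) (P : Ideal S)
    (h : (P ≤ maximalIdeal S ∧ ∃ g : S, f - g ^ p ∈ P ^ p) ∨ (∃ g : S, f - g ^ p ∈ maximalIdeal S ^ p)) :
    ∃ g : S, f - g ^ p ∈ maximalIdeal S ^ 2 := by
  rcases h with ⟨hP, g, hg⟩ | ⟨g, hg⟩
  · exact ⟨g, Ideal.pow_le_pow_right hp (Ideal.pow_right_mono hP p hg)⟩
  · exact ⟨g, Ideal.pow_le_pow_right hp hg⟩

/-- **The witness descends**: along a ring map `π : R → A` with `π(𝔪_R) ⊆ 𝔪_A` (any local map, any surjection of local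
rings), `f − g^p ∈ 𝔪_R²` gives `π f − (π g)^p ∈ 𝔪_A²`. [folklore] -/
theorem exists_sub_pow_mem_sq_map {R : Type u} {A : Type v} [CommRing R] [CommRing A] [IsLocalRing R] [IsLocalRing A]
    (π : R →+* A) (hπ : ∀ m ∈ maximalIdeal R, π m ∈ maximalIdeal A) {p : ℕ} {f : R}
    (h : ∃ g : R, f - g ^ p ∈ maximalIdeal R ^ 2) : ∃ g' : A, π f - g' ^ p ∈ maximalIdeal A ^ 2 := by
  obtain ⟨g, hg⟩ := h
  refine ⟨π g, ?_⟩
  rw [← map_pow, ← map_sub]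
  have hle : (maximalIdeal R ^ 2).map π ≤ maximalIdeal A ^ 2 := by
    rw [Ideal.map_pow]
    exact Ideal.pow_right_mono (Ideal.map_le_iff_le_comap.mpr fun m hm => Ideal.mem_comap.mpr (hπ m hm)) 2
  exact hle (Ideal.mem_map_of_mem π hg)

/-- **A ring isomorphic to a singular radicand germ is not regular**: if `A` is a regular local ring of
characteristic `p`, `h − g^p ∈ 𝔪_A²` for some `g`, and `Y ≅ A[T]/(T^p − h)`, then `Y` is not a regular local ring
(res-type-082's criterion + transport of regularity along `≃+*`). [cite: Matsumura1987, Thm. 14.2] -/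
theorem not_isRegularLocalRing_of_ringEquiv_adjoinRoot {A : Type u} [CommRing A] [IsRegularLocalRing A]
    (p : ℕ) [Fact p.Prime] [CharP A p] (h : A) (hh : ∃ g : A, h - g ^ p ∈ maximalIdeal A ^ 2)
    {Y : Type v} [CommRing Y] (e : Y ≃+* AdjoinRoot (X ^ p - C h : A[X])) : ¬ IsRegularLocalRing Y := by
  intro hY
  haveI := hY
  exact (RadicandSingular.not_isRegularLocalRing_adjoinRoot_iff p h).mpr hh (IsRegularLocalRing.of_ringEquiv e)

/-- The radicand germ of a regular local member itself: `f − g^p ∈ 𝔪²` ⇒ `R[T]/(T^p − f)` is not regular (the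
criterion, restated for the consumer's convenience). [cite: Matsumura1987, Thm. 14.2] -/
theorem not_isRegularLocalRing_adjoinRoot_of_exists {A : Type u} [CommRing A] [IsRegularLocalRing A]
    (p : ℕ) [Fact p.Prime] [CharP A p] (f : A) (hf : ∃ g : A, f - g ^ p ∈ maximalIdeal A ^ 2) :
    ¬ IsRegularLocalRing (AdjoinRoot (X ^ p - C f : A[X])) :=
  (RadicandSingular.not_isRegularLocalRing_adjoinRoot_iff p f).mpr hf

/-- **Every steered stage is singular** (run level; abstract permissibility predicate `Perm` of which only
«`Perm S f P → P ≠ 𝔪 ∧ P` prime `∧ ∃ g, f − g^p ∈ P^p`» is consumed, run clause = the skeleton's `IsSteeredRun`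
unfolded as in `SteeredRun.isRegularLocalRing_of_steeredRunUpTo` / `RankFourExit.rankFour_exit_two`): at every stage
`i` of a σ_top-steered run in characteristic `p` whose member `R i` is regular, the radicand `s_i^p` is a `p`-th power
to second order and the germ `(R i)[T]/(T^p − s_i^p)` is NOT regular. [folklore] -/
theorem steeredStage_singular {K : Type} [Field K] (p : ℕ) [Fact p.Prime] [CharP K p]
    (Perm : ∀ S : Subring K, IsLocalRing S → S → Ideal S → Prop)
    (hPerm : ∀ (S : Subring K) (hS : IsLocalRing S) (f : S) (P : Ideal S),
      Perm S hS f P → P ≠ maximalIdeal S ∧ P.IsPrime ∧ ∃ g : S, f - g ^ p ∈ P ^ p)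
    (O : ValuationSubring K) (R : ℕ → Subring K) (P : (i : ℕ) → Ideal (R i)) (s : ℕ → K)
    (hrun : ∀ i, ∃ (hL : IsLocalRing (R i)) (hs : s i ^ p ∈ R i),
      (Perm (R i) hL ⟨s i ^ p, hs⟩ (P i) ∨
        (P i = maximalIdeal (R i) ∧ (∀ Q : Ideal (R i), ¬ Perm (R i) hL ⟨s i ^ p, hs⟩ Q) ∧
          ∃ g : R i, (⟨s i ^ p, hs⟩ : R i) - g ^ p ∈ maximalIdeal (R i) ^ p)) ∧
      IsLocalBlowupAlong O (R i) (P i) (R (i + 1)) ∧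
      ∃ x g : K, ((∃ hx : x ∈ R i, (⟨x, hx⟩ : R i) ∈ P i) ∧ x ≠ 0 ∧
        ∀ y : R i, y ∈ P i → O.valuation (y : K) ≤ O.valuation x) ∧ g ∈ R i ∧
        s i = x * s (i + 1) + g)
    (i : ℕ) (hreg : IsRegularLocalRing (R i)) :
    ∃ (_ : IsLocalRing (R i)) (hs : s i ^ p ∈ R i),
      (∃ g : R i, (⟨s i ^ p, hs⟩ : R i) - g ^ p ∈ maximalIdeal (R i) ^ 2) ∧
      ¬ IsRegularLocalRing (AdjoinRoot (X ^ p - C (⟨s i ^ p, hs⟩ : R i) : (R i)[X])) := by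
  obtain ⟨hL, hs, hC, -, -⟩ := hrun i
  haveI := hreg
  have hex : ∃ g : R i, (⟨s i ^ p, hs⟩ : R i) - g ^ p ∈ maximalIdeal (R i) ^ 2 := by
    refine exists_sub_pow_mem_sq_of_centre (Fact.out : p.Prime).two_le _ (P i) ?_
    rcases hC with hperm | ⟨-, -, hg⟩
    · obtain ⟨-, hprime, hg⟩ := hPerm _ hL _ _ hperm
      exact Or.inl ⟨IsLocalRing.le_maximalIdeal hprime.ne_top, hg⟩
    · exact Or.inr hg
  exact ⟨inferInstance, hs, hex, not_isRegularLocalRing_adjoinRoot_of_exists p _ hex⟩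

/-! ## §2 (append) The critical-surface form of D3d: images and presentations -/

/-- **D3d at the level of the LOW tower** (presentation-agnostic): let `φ : R → A` be a SURJECTIVE ring map of
local rings (the residue map of the critical surface restricted to a member, `A = φ(R)`), `A` regular local of
characteristic `p`, `f ∈ R` a radicand which is a `p`-th power to second order (`f − g^p ∈ 𝔪_R²`, e.g. from
`steeredStage_singular`), and `Y` ANY ring isomorphic to the radicand germ `A[T]/(T^p − φ f)`. Then `Y` is not a
regular local ring. (Surjective maps of local rings are local: `IsLocalRing.map_maximalIdeal_of_surjective`.)
[cite: Matsumura1987, Thm. 14.2] -/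
theorem not_isRegularLocalRing_of_surjective_of_ringEquiv {R : Type u} {A : Type v} [CommRing R] [IsLocalRing R]
    [CommRing A] [IsRegularLocalRing A] (p : ℕ) [Fact p.Prime] [CharP A p]
    (φ : R →+* A) (hφ : Function.Surjective φ) {f : R} (hf : ∃ g : R, f - g ^ p ∈ maximalIdeal R ^ 2)
    {Y : Type} [CommRing Y] (e : Y ≃+* AdjoinRoot (X ^ p - C (φ f) : A[X])) : ¬ IsRegularLocalRing Y :=
  not_isRegularLocalRing_of_ringEquiv_adjoinRoot p (φ f)
    (exists_sub_pow_mem_sq_map φ (fun m hm => by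
      rw [← IsLocalRing.map_maximalIdeal_of_surjective φ hφ]; exact Ideal.mem_map_of_mem φ hm) hf) e

/-- The same with the radicand identified up to equality in `A` (`h = φ f`, e.g. `h_n = φ(s_n²)` in the LOW tower)
and the isomorphism in either direction. [cite: Matsumura1987, Thm. 14.2] -/
theorem not_isRegularLocalRing_of_surjective_of_ringEquiv' {R : Type u} {A : Type v} [CommRing R] [IsLocalRing R]
    [CommRing A] [IsRegularLocalRing A] (p : ℕ) [Fact p.Prime] [CharP A p]
    (φ : R →+* A) (hφ : Function.Surjective φ) {f : R} (hf : ∃ g : R, f - g ^ p ∈ maximalIdeal R ^ 2)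
    {h : A} (hh : φ f = h)
    {Y : Type} [CommRing Y] (e : AdjoinRoot (X ^ p - C h : A[X]) ≃+* Y) : ¬ IsRegularLocalRing Y := by
  subst hh
  exact not_isRegularLocalRing_of_surjective_of_ringEquiv p φ hφ hf e.symm

end Summit.ResolutionOfSingularities.ResolutionOfSingularities.Theorems.SwitchingDichotomy.LowStageSingular

end
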